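import Summits.Ventures.PercRepro.S1KillMixedLadder
import Summits.Ventures.PercRepro.S1CellNineThirteen

/-!
# PercRepro — THE CELL `(9, 6)` MODULO THREE BOUNDED CAP TABLES (p2, gen 26; SUBCLAIM-S1 §6.10)

The fourth row-9 cell typed: on the coloop-free `15`-point core (`t ≤ triT 6 15 = 7`) the mixed kill closes `t = 0` at
`gbP 6 15 = 31` and needs `28 / 25 / 21 / 17 / 12 / 6 / 0` at `t = 1 … 7`; with one coloop (`14` points, `t ≤ 7`) the
mixed LADDER consumer closes `t = 0` at `gbP 6 14 = 33` and needs `31 / 27 / 23 / 19 / 15 / 10 / 5`; with two coloops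
(`13` points, `t ≤ triT 6 13 = 8`) it closes `t ≤ 2` at `gbP 6 13 = 36` and needs `32 / 28 / 24 / 20 / 15 / 10` at
`t = 3 … 8`; `c ≥ 3` is lossy (exact twin mining/p2/g26/caps96m.py). The lines above triT's range — which no four-circuit
cap closes — are never priced.

* `capNineSix15 / 14 / 13`, `mkNineSix0 / 1 / 2`, `m4NineSix` — the tables;
* **`c025_core_nine_six_of_caps`** — `RLS` at `(9, 4)` on every `e`-free core of rank `9` with `15` points modulo
  (P9,6,15), (P9,6,14), (P9,6,13) as stated.
Axioms: standard.
-/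

open scoped Matroid

namespace PercRepro

namespace S1

open Set

variable {α : Type}

/-- The values of `gbP` and `triT` on the `(9, 6)` cores. -/
theorem nineSix_values : gbP 6 15 = 31 ∧ gbP 6 14 = 33 ∧ gbP 6 13 = 36 ∧ triT 6 15 = 7 ∧ triT 6 14 = 7 ∧
    triT 6 13 = 8 := by
  decide

/-- The four-circuit caps of the coloop-free `15`-point lines at `t = 0 … 7`. -/
def capNineSix15 (t : ℕ) : ℕ := [31, 28, 25, 21, 17, 12, 6, 0].getD t 0

/-- The four-circuit caps of the one-coloop `14`-point lines at `t = 0 … 7`. -/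
def capNineSix14 (t : ℕ) : ℕ := [33, 31, 27, 23, 19, 15, 10, 5].getD t 5

/-- The four-circuit caps of the two-coloop `13`-point lines at `t = 0 … 8`. -/
def capNineSix13 (t : ℕ) : ℕ := [36, 36, 36, 32, 28, 24, 20, 15, 10].getD t 10

/-- The triangles in the kill, coloop-free case. -/
def mkNineSix0 (t : ℕ) : ℕ := min t 5

/-- The triangles in the kill, one coloop. -/
def mkNineSix1 (t : ℕ) : ℕ := min t 6

/-- The triangles in the kill, two coloops. -/
def mkNineSix2 (t : ℕ) : ℕ := min t 8

/-- The four-circuits in the kill: `3, 2, 1` at `t = 0, 1, 2`, none beyond. -/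
def m4NineSix (t : ℕ) : ℕ := [3, 2, 1].getD t 0

/-- **THE CELL `(9, 6)` MODULO THREE BOUNDED CAP TABLES**. -/
theorem c025_core_nine_six_of_caps (M : Matroid α) [M.Finite] (hR : M.eRank = (9 : ℕ)) (hn : M.E.ncard = 15)
    (hfree : ∀ e ∈ M.E, ∃ A ⊆ M.E \ {e}, e ∉ M.closure A ∧ e ∉ M.closure ((M.E \ {e}) \ A))
    (hcap15 : ∀ (N : Matroid α) [N.Finite],
      (∀ e ∈ N.E, ∃ A ⊆ N.E \ {e}, e ∉ N.closure A ∧ e ∉ N.closure ((N.E \ {e}) \ A)) →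
      N.E.encard = N.eRank + ((6 : ℕ) : ℕ∞) → N.E.ncard = 15 → N.coloops = ∅ →
      ∀ t, 1 ≤ t → t ≤ 7 → {C : Set α | N.IsCircuit C ∧ C.ncard = 3}.ncard = t →
      {C : Set α | N.IsCircuit C ∧ C.ncard = 4}.ncard ≤ capNineSix15 t)
    (hcap14 : ∀ (N : Matroid α) [N.Finite],
      (∀ e ∈ N.E, ∃ A ⊆ N.E \ {e}, e ∉ N.closure A ∧ e ∉ N.closure ((N.E \ {e}) \ A)) →
      N.E.encard = N.eRank + ((6 : ℕ) : ℕ∞) → N.E.ncard = 14 → N.coloops = ∅ →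
      ∀ t, 1 ≤ t → t ≤ 7 → {C : Set α | N.IsCircuit C ∧ C.ncard = 3}.ncard = t →
      {C : Set α | N.IsCircuit C ∧ C.ncard = 4}.ncard ≤ capNineSix14 t)
    (hcap13 : ∀ (N : Matroid α) [N.Finite],
      (∀ e ∈ N.E, ∃ A ⊆ N.E \ {e}, e ∉ N.closure A ∧ e ∉ N.closure ((N.E \ {e}) \ A)) →
      N.E.encard = N.eRank + ((6 : ℕ) : ℕ∞) → N.E.ncard = 13 → N.coloops = ∅ →
      ∀ t, 3 ≤ t → t ≤ 8 → {C : Set α | N.IsCircuit C ∧ C.ncard = 3}.ncard = t →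
      {C : Set α | N.IsCircuit C ∧ C.ncard = 4}.ncard ≤ capNineSix13 t) :
    ThmN.RLS M 9 4 := by
  rcases (show M.coloops.ncard = 0 ∨ M.coloops.ncard = 1 ∨ M.coloops.ncard = 2 ∨ 3 ≤ M.coloops.ncard by omega)
    with h | h | h | h
  · have hcol : M.coloops = ∅ := (Set.ncard_eq_zero (M.ground_finite.subset M.coloops_subset_ground)).1 h
    have hd : M.E.encard = M.eRank + ((6 : ℕ) : ℕ∞) := by
      rw [hR, ← M.ground_finite.cast_ncard_eq, hn]; norm_num
    have hP' : {C : Set α | M.IsCircuit C ∧ C.ncard = 3}.ncard ≤ 7 := by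
      have := ncard_triangles_le_triT 6 M hfree hd hcol
      rwa [hn, nineSix_values.2.2.2.1] at this
    refine rls_of_kill_case_mixed_capT' M (p := 9) (d := 6) hR hn hfree hcol (by norm_num) (by norm_num)
      (P := 7) (S5 := 175) capNineSix15 hP' ?_ (by decide) mkNineSix0 m4NineSix (by decide)
      (by decide +kernel) (by decide +kernel)
    intro N _ hNfree hNd hNn hNcol t hs
    rcases Nat.eq_zero_or_pos t with h0 | hpos
    · have hg := ncard_fourCircuits_le_gbP_of_coloopFree N hNfree hNd hNcol hNn
      rw [nineSix_values.1] at hg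
      rw [h0]; exact hg
    · have h7 : t ≤ 7 := by
        have := ncard_triangles_le_triT 6 N hNfree hNd hNcol
        rwa [hNn, nineSix_values.2.2.2.1, hs] at this
      exact hcap15 N hNfree hNd hNn hNcol t hpos h7 hs
  · refine rls_of_ladder_case_kill_mixed_capT M (p := 8) (c := 1) (d := 6) (by norm_num) (by norm_num) hR hn hfree h
      (by norm_num) (by norm_num) (P := 7) (S5 := 182) capNineSix14 ?_ ?_ (by decide) mkNineSix1 m4NineSix
      (by decide) (by decide +kernel) (by decide +kernel)
    · intro N _ hNfree hNd hNn hNcol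
      have := ncard_triangles_le_triT 6 N hNfree hNd hNcol
      rwa [hNn, nineSix_values.2.2.2.2.1] at this
    · intro N _ hNfree hNd hNn hNcol t hs
      rcases Nat.eq_zero_or_pos t with h0 | hpos
      · have hg := ncard_fourCircuits_le_gbP_of_coloopFree N hNfree hNd hNcol hNn
        rw [nineSix_values.2.1] at hg
        rw [h0]; exact hg
      · have h7 : t ≤ 7 := by
          have := ncard_triangles_le_triT 6 N hNfree hNd hNcol
          rwa [hNn, nineSix_values.2.2.2.2.1, hs] at this
        exact hcap14 N hNfree hNd hNn hNcol t hpos h7 hs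
  · refine rls_of_ladder_case_kill_mixed_capT M (p := 7) (c := 2) (d := 6) (by norm_num) (by norm_num) hR hn hfree h
      (by norm_num) (by norm_num) (P := 8) (S5 := 190) capNineSix13 ?_ ?_ (by decide) mkNineSix2 m4NineSix
      (by decide) (by decide +kernel) (by decide +kernel)
    · intro N _ hNfree hNd hNn hNcol
      have := ncard_triangles_le_triT 6 N hNfree hNd hNcol
      rwa [hNn, nineSix_values.2.2.2.2.2] at this
    · intro N _ hNfree hNd hNn hNcol t hs
      rcases Nat.lt_or_ge t 3 with h3 | h3
      · have hg := ncard_fourCircuits_le_gbP_of_coloopFree N hNfree hNd hNcol hNn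
        rw [nineSix_values.2.2.1] at hg
        have hc : capNineSix13 t = 36 := by
          unfold capNineSix13
          interval_cases t <;> rfl
        rw [hc]; exact hg
      · have h8 : t ≤ 8 := by
          have := ncard_triangles_le_triT 6 N hNfree hNd hNcol
          rwa [hNn, nineSix_values.2.2.2.2.2, hs] at this
        exact hcap13 N hNfree hNd hNn hNcol t h3 h8 hs
  · exact rls_of_coloops_lossy M (p := 6) (c := 3) (hR.trans (by norm_num)) (by norm_num) h phiK_nine_four_le

end S1

end PercRepro
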